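import Summits.CriticalPhenomena.Ising3DConformalLimit.Theses.FourToThreeSlab
import Literature.Probability.LatticeModels.IsingSlab
import HarnessLib

/-!
# Birth skeleton (BC3) — crux `RingFamilyUniversality` (item stmt-CriticalPhenomena-11229), route `FourToThreeSlab`

Crux (route file `Summits/CriticalPhenomena/Ising3DConformalLimit/Theses/FourToThreeSlab.lean`, rank 4, decl
`Summit.CriticalPhenomena.Ising3DConformalLimit.Theses.FourToThreeSlab.RingFamilyUniversality`, concluded BY NAME
below): ONE-RING DESCENT — for every `M ≥ 1`, if the critical nearest-neighbour Ising model on the slab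
`ℤ³ × ℤ_(M+1)` (plus state, `h = 0`, its own `β_c(M+1)`), read on the layer `ℤ³ × {0}`, has a pointwise scaling
limit of the conjunct's shape (`∃ ρ > 0, Δ > 0, S` with `HasPointwiseScalingLimit`, `IsNondegenerateTwoPoint`,
`IsMoebiusCovariant Δ`, `HasNontrivialU4`) — the slab property `P(M+1)` — then so does `ℤ³ × ℤ_M` at `β_c(M)`
(`P(M)`). Definitionally `RingFamilyUniversality ↔ ∀ M [NeZero M], P(M+1) → P(M)` with
`P M = SlabConformalLimit M` below, stated through the landed Literature definition
`Literature.Probability.LatticeModels.slabCriticalCorr 3 M` (`IsingSlab.lean`, letter for letter the family inlined in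
the route, `slabCriticalCorr_eq : … = … := rfl`); `ringFamilyUniversality_iff : … := Iff.rfl` guards the reading.
Registrar: `planner-skel-stmt-CriticalPhenomena-11229-0` (skeleton-register, route re-audit bin REPAIRABLE, 2026-08-17).

## The line: the route header's expected strengthening "adjacent ring sizes have the SAME limit", cut in two

The route header (TWO-LAYER PLAN; crux docstring) expects the crux in the stronger form "same `Δ` and the same
`S` up to normalisation" (`ThickSlabLimitsAgree`): after integrating out the ring, the `M`- and `(M+1)`-ring
slabs are two reflection-positive 3D ferromagnets on the critical surface of the SAME infrared fixed point
(KochWittwer1986 §1; Cardy1996 §4.5; OconnorStephens1994), so the `M`-slab correlators, renormalised by their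
own `ρ'`, converge to the very family `S` that is the `(M+1)`-slab limit. That transfer is registered as two
named stubs — the classical order in which universality is established and tested, metric data first:

* `stub_twoPointTransfer` — **TWO-POINT UNIVERSALITY ONE RING DOWN (normalisation matching).** Given the
  `(M+1)`-slab limit data `(ρ, Δ, S)` of `P(M+1)`, there is a renormalisation `ρ' > 0` on `(0,1]` under which
  the critical TWO-POINT function of the `M`-slab converges, locally uniformly off the diagonal, to `S 2`.
  Since `S` is Möbius covariant and non-degenerate, `S 2 (x,y) = C‖x−y‖^(−2Δ)`: the stub says exactly that
  `⟨σ_(0,0)σ_(x,0)⟩⁺_(M;β_c(M))` is asymptotically ISOTROPIC and REGULARLY VARYING with the same index `2Δ` as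
  for `M+1` rings — `η(M) = η(M+1)` together with existence of the two-point scaling function (the free
  constant `C`, i.e. the field-strength renormalisation of the `M`-slab, is absorbed in `ρ'`). Handles: GKS
  monotonicity of slab correlations in the volume and in added bonds (`IsingSlab`, `GKSInequalities`),
  reflection positivity of both slabs in the `ℤ³` directions (spectral/Källén–Lehmann representation of the
  layer-0 two-point function along an axis, infrared bound), Simon–Lieb and the sharpness of `β_c(M)`;
  none compares two DIFFERENT critical models, which is the open core. Why it might fail: `η(M) ≠ η(M+1)`
  (adjacent ring sizes in different infrared classes), or the `M`-slab two-point function oscillates between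
  two powers (no regular variation) — at `M = 1` either is a statement about `ℤ³` itself. [open; XL]
* `stub_higherPointTransfer` — **THE TWO-POINT FUNCTION SLAVES THE HIGHER CORRELATIONS ALONG THE FAMILY.**
  If, under some `ρ' > 0`, the `M`-slab two-point function converges to `S 2` (`S` the non-degenerate,
  Möbius-covariant, NON-GAUSSIAN `(M+1)`-slab limit), then under the same `ρ'` ALL `n`-point functions of
  the `M`-slab converge to `S n`: `HasPointwiseScalingLimit (slabCriticalCorr 3 M) ρ' S`. Handles: once the
  two-point scale `ρ'` is matched, the rescaled `n`-point functions are locally bounded above by Newman's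
  Gaussian-pairing inequality `⟨σ_A⟩ ≤ Σ_pairings ∏ ⟨σσ⟩` (Newman1975Gaussian) and below by GKS
  (`⟨σ_Aσ_B⟩ ≥ ⟨σ_A⟩⟨σ_B⟩`), so tightness is free and the content is equicontinuity + IDENTIFICATION of
  every subsequential limit with `S n` (in particular: the `M`-slab does not Gaussianise — a Gaussian family
  with two-point function `S 2` is the competitor to exclude, cf. `HasNontrivialU4 S`). Why it might fail:
  two critical RP ferromagnets with asymptotically proportional two-point functions but different connected
  four-point scaling functions (same `Δ_σ`, different OPE data) — conceivable in general, excluded here only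
  by the universality conjecture itself. [open; XL — the hardest stub]

`RingFamilyUniversality_of : Sig.stub_twoPointTransfer → Sig.stub_higherPointTransfer → RingFamilyUniversality`
is the kernel-checked composition (pure logic, sorry-free): destructure `P(M+1)` into `(ρ, Δ, S)` and its four
properties, take `ρ'` from the first stub, the full limit from the second, and re-use `Δ, S` (whose
non-degeneracy, Möbius covariance and `U₄ ≢ 0` are properties of `S` alone) to witness `P(M)`. Its hypotheses
are the stub statements BY NAME (`Sig.stub_*`, `abbrev`s repeating the registered signatures verbatim — the
form `#h21_check_skeleton` admits, as in the sibling skeletons `Cruxes/PointwiseLimit/Lines/birth.lean`,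
`Cruxes/LimitsAreConformal/Lines/birth.lean`); the closing `example` feeds it the registered stubs.

Neither stub is the crux or the summit in disguise (BC3 probes, NOTES.md of the registrar: `stub → crux` and
`stub → Ising3DConformalLimit` by `first | exact? | simpa | aesop` fail for both): the first gives no `n`-point
convergence, the second has nothing to start from without a matched `ρ'`; conversely the crux implies neither
(its `P(M)` may have a limit `S'` unrelated to `S`) — both are consequences of the STRONG form only.

Disproof / negatives: no `Disproof.lean` exists for this crux (`ledger crux ls stmt-CriticalPhenomena-11229`: no
workfiles, 2026-08-17); `ledger negatives --problem CriticalPhenomena` (11 entries) has nothing in this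
sub-problem; the barrier `Literature.Barriers.CriticalPhenomena.SlabLimitUniformControl` (uniform-in-width
control = the full problem) is respected — every statement here is at fixed `M`, no uniformity in `M` is
claimed; `ScaleCovarianceNotMoebius` does not bite — no upgrade from scale to Möbius covariance is asserted,
`S` is Möbius covariant by hypothesis and is transferred whole.

Sorries: exactly two, inside `stub_twoPointTransfer` and `stub_higherPointTransfer`; zero elsewhere.
-/

noncomputable section

namespace Summit.CriticalPhenomena.Ising3DConformalLimit.Cruxes.RingFamilyUniversality.Birth

open Literature.Probability.LatticeModels Filter Set
open scoped Topology
open Summit.CriticalPhenomena.Ising3DConformalLimit.Theses.FourToThreeSlab (RingFamilyUniversality)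

/-! ## Reading of the crux through the landed slab vocabulary (`IsingSlab.lean`) -/

/-- **The slab property `P(M)`**: the critical layer-`0` correlators `slabCriticalCorr 3 M` of `ℤ³ × ℤ_M`
(plus state at its own `β_c(M)`) have a pointwise scaling limit of the conjunct's shape — some renormalisation
`ρ > 0` on `(0,1]`, some `Δ > 0` and a continuum family `S` that is non-degenerate, Möbius covariant with
weight `Δ` and non-Gaussian. Verbatim the hypothesis (`M+1`) / conclusion (`M`) of the crux, with the inlined
correlator family replaced by its `rfl`-equal Literature name. -/
abbrev SlabConformalLimit (M : ℕ) [NeZero M] : Prop :=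
  ∃ (ρ : ℝ → ℝ) (Δ : ℝ) (S : CorrFamily 3), (∀ δ ∈ Set.Ioc (0:ℝ) 1, 0 < ρ δ) ∧ 0 < Δ ∧
    HasPointwiseScalingLimit (slabCriticalCorr 3 M) ρ S ∧ IsNondegenerateTwoPoint S ∧
    IsMoebiusCovariant Δ S ∧ HasNontrivialU4 S

/-- Reading guard (`Iff.rfl`): the crux IS one-ring descent of the slab property,
`∀ M ≥ 1, P(M+1) → P(M)`. -/
theorem ringFamilyUniversality_iff :
    RingFamilyUniversality ↔ ∀ (M : ℕ) [NeZero M], SlabConformalLimit (M + 1) → SlabConformalLimit M :=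
  Iff.rfl

/-! ## Registered stubs (the only `sorry`s of this file) -/

/-- **STUB 1 — two-point universality one ring down (normalisation matching).** For every `M ≥ 1`: if the
`(M+1)`-ring critical slab has limit data `(ρ, Δ, S)` as in `P(M+1)`, then for some renormalisation `ρ' > 0`
on `(0,1]` the rescaled critical TWO-POINT function of the `M`-ring slab,
`ρ'(δ)² ⟨σ_([x/δ],0) σ_([y/δ],0)⟩⁺_(M; β_c(M))`, converges as `δ → 0⁺`, locally uniformly on `{x ≠ y}`, to the
SAME two-point function `S 2` (`= C‖x−y‖^(−2Δ)` by Möbius covariance): `η(M) = η(M+1)` plus isotropy and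
regular variation of the `M`-slab two-point function. OPEN (no theorem compares two different critical 3D
models; at `M = 1` it speaks about `ℤ³`). [KochWittwer1986 §1; Cardy1996 §4.5; OconnorStephens1994;
FriedliVelenik2017 §3 (GKS); DuminilCopinICM2022 §8.4] -/
theorem stub_twoPointTransfer :
    ∀ (M : ℕ) [NeZero M] (ρ : ℝ → ℝ) (Δ : ℝ) (S : CorrFamily 3),
      (∀ δ ∈ Set.Ioc (0:ℝ) 1, 0 < ρ δ) → 0 < Δ →
      HasPointwiseScalingLimit (slabCriticalCorr 3 (M + 1)) ρ S → IsNondegenerateTwoPoint S →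
      IsMoebiusCovariant Δ S → HasNontrivialU4 S →
      ∃ ρ' : ℝ → ℝ, (∀ δ ∈ Set.Ioc (0:ℝ) 1, 0 < ρ' δ) ∧
        TendstoLocallyUniformlyOn (rescaledCorrelator (slabCriticalCorr 3 M) ρ' 2) (S 2)
          (𝓝[>] (0 : ℝ)) (NonCoincident 3 2) := by
  sorry

/-- **STUB 2 — the two-point function slaves the higher correlations along the family (the hardest stub).**
For every `M ≥ 1`, limit data `(ρ, Δ, S)` of the `(M+1)`-ring critical slab as in `P(M+1)` (`S` non-degenerate,
Möbius covariant, NON-GAUSSIAN) and every renormalisation `ρ' > 0` on `(0,1]` under which the `M`-ring critical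
two-point function converges to `S 2`: under the same `ρ'` ALL the rescaled `n`-point functions of the
`M`-ring slab converge to `S n`, locally uniformly off the diagonals — `HasPointwiseScalingLimit
(slabCriticalCorr 3 M) ρ' S`. Tightness is free once `ρ'` is matched (Newman's Gaussian-pairing upper bound,
GKS lower bounds); the content is the identification of every subsequential limit with `S` — in particular the
`M`-slab does not Gaussianise. OPEN. [Newman1975Gaussian; GriffithsSimon1973; KochWittwer1986 §1;
Cardy1996 §4.5; DuminilCopinICM2022 §8.1–8.4] -/
theorem stub_higherPointTransfer :
    ∀ (M : ℕ) [NeZero M] (ρ ρ' : ℝ → ℝ) (Δ : ℝ) (S : CorrFamily 3),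
      (∀ δ ∈ Set.Ioc (0:ℝ) 1, 0 < ρ δ) → (∀ δ ∈ Set.Ioc (0:ℝ) 1, 0 < ρ' δ) → 0 < Δ →
      HasPointwiseScalingLimit (slabCriticalCorr 3 (M + 1)) ρ S → IsNondegenerateTwoPoint S →
      IsMoebiusCovariant Δ S → HasNontrivialU4 S →
      TendstoLocallyUniformlyOn (rescaledCorrelator (slabCriticalCorr 3 M) ρ' 2) (S 2)
        (𝓝[>] (0 : ℝ)) (NonCoincident 3 2) →
      HasPointwiseScalingLimit (slabCriticalCorr 3 M) ρ' S := by
  sorry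

/-! ### The two stub statements BY NAME — the hypotheses of `RingFamilyUniversality_of`

The native skeleton audit (`#h21_check_skeleton`, run by `ledger skeleton check`) admits a hypothesis of the
composing theorem only if its head constant is a registered obligation or is NAMED like a declared stub; so each
registered stub `stub_X : <signature> := by sorry` above is mirrored by `abbrev Sig.stub_X : Prop := <the same
signature, verbatim>` and `RingFamilyUniversality_of` is stated over the two aliases. -/
namespace Sig

/-- Alias of the statement of the registered stub `stub_twoPointTransfer`, keyed by its name. -/
abbrev stub_twoPointTransfer : Prop :=
  ∀ (M : ℕ) [NeZero M] (ρ : ℝ → ℝ) (Δ : ℝ) (S : CorrFamily 3),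
    (∀ δ ∈ Set.Ioc (0:ℝ) 1, 0 < ρ δ) → 0 < Δ →
    HasPointwiseScalingLimit (slabCriticalCorr 3 (M + 1)) ρ S → IsNondegenerateTwoPoint S →
    IsMoebiusCovariant Δ S → HasNontrivialU4 S →
    ∃ ρ' : ℝ → ℝ, (∀ δ ∈ Set.Ioc (0:ℝ) 1, 0 < ρ' δ) ∧
      TendstoLocallyUniformlyOn (rescaledCorrelator (slabCriticalCorr 3 M) ρ' 2) (S 2)
        (𝓝[>] (0 : ℝ)) (NonCoincident 3 2)

/-- Alias of the statement of the registered stub `stub_higherPointTransfer`, keyed by its name. -/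
abbrev stub_higherPointTransfer : Prop :=
  ∀ (M : ℕ) [NeZero M] (ρ ρ' : ℝ → ℝ) (Δ : ℝ) (S : CorrFamily 3),
    (∀ δ ∈ Set.Ioc (0:ℝ) 1, 0 < ρ δ) → (∀ δ ∈ Set.Ioc (0:ℝ) 1, 0 < ρ' δ) → 0 < Δ →
    HasPointwiseScalingLimit (slabCriticalCorr 3 (M + 1)) ρ S → IsNondegenerateTwoPoint S →
    IsMoebiusCovariant Δ S → HasNontrivialU4 S →
    TendstoLocallyUniformlyOn (rescaledCorrelator (slabCriticalCorr 3 M) ρ' 2) (S 2)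
      (𝓝[>] (0 : ℝ)) (NonCoincident 3 2) →
    HasPointwiseScalingLimit (slabCriticalCorr 3 M) ρ' S

end Sig

/-! ## Composition — the crux BY NAME (sorry-free) -/

/-- **COMPOSITION** (kernel-checked, sorry-free). `Sig.stub_twoPointTransfer → Sig.stub_higherPointTransfer →
FourToThreeSlab.RingFamilyUniversality`: given `P(M+1)` with data `(ρ, Δ, S)`, STUB 1 supplies the matched
renormalisation `ρ'` and two-point convergence of the `M`-slab to `S 2`, STUB 2 upgrades it to convergence of all
`n`-point functions to `S`, and `(ρ', Δ, S)` witnesses `P(M)` — non-degeneracy, Möbius covariance and `U₄ ≢ 0`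
being properties of `S` alone. Hypotheses = the stub statements by name, conclusion = the crux by name. -/
theorem RingFamilyUniversality_of :
    Sig.stub_twoPointTransfer → Sig.stub_higherPointTransfer → RingFamilyUniversality := by
  intro h2pt hnpt
  rw [ringFamilyUniversality_iff]
  intro M _ hP
  obtain ⟨ρ, Δ, S, hρ, hΔ, hlim, hnd, hmob, hu4⟩ := hP
  obtain ⟨ρ', hρ', h2⟩ := h2pt M ρ Δ S hρ hΔ hlim hnd hmob hu4
  exact ⟨ρ', Δ, S, hρ', hΔ, hnpt M ρ ρ' Δ S hρ hρ' hΔ hlim hnd hmob hu4 h2, hnd, hmob, hu4⟩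

/-- The crux from the registered stubs — closed modulo exactly `stub_twoPointTransfer`,
`stub_higherPointTransfer` (kernel-checked `example`, deliberately NOT a named declaration: it depends on the
stubs' `sorry`s until they land; it also certifies that the `Sig` aliases are the stubs' types). -/
example : RingFamilyUniversality :=
  RingFamilyUniversality_of stub_twoPointTransfer stub_higherPointTransfer

end Summit.CriticalPhenomena.Ising3DConformalLimit.Cruxes.RingFamilyUniversality.Birth

end
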